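import Literature.MathematicalPhysics.QuantumFieldTheory.Balaban1983to89.B12RegularSpaces111Mono
import Literature.MathematicalPhysics.QuantumFieldTheory.Balaban1983to89.B12RegularSpaces111Gauge

/-!
# `Balaban1983to89.B13Space134` — T. Bałaban, *Renormalization group approach to lattice gauge field theories. II. Cluster
expansions*, Commun. Math. Phys. **116** (1988) 1–22 [Balaban1988RG2Cluster]: the analyticity space (1.34) p. 9 of Lemmas 1 and 2,
`U^c_{k+1}(Y, (1+β)α₀, (1+β)α₁, α₀) × {B : |B| < ε₁g_k⁻¹ on Y}`, as ONE concrete set over the landed single-scale spaces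
`B12RegularSpaces111.space` of [I] §1; PROVED: the inductive assumption's space times the ball lies in it («slightly better than demanded»,
p. 11), monotonicity, and the gauge clause of Lemma 2 for this space — the first factor is invariant under ALL `Gᶜ`-valued gauge
transformations (a union of orbits), the `B`-ball is invariant under `G`-valued ones and is carried into the ball dilated by
`sup ‖u‖‖u⁻¹‖` by `Gᶜ`-valued ones («in a sufficiently small neighborhood of all G-valued transformations»); non-vacuity

HONEST FRAMING (cell `lit-balaban`, verbatim): statement-level skeleton of published theorems with citation tags; proofs where landed; nothing here is a claim about the Yang–Mills mass gap.

PDF held: `paper:balaban1988-cmp116-rg-ii-cluster` (journal page = PDF page); read from the text layer of PDF pp. 9 and 11 (`lit read …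
--pages 9-11`); [I] = [Balaban1987RG1] p. 276 for (I.3.29) (text layer of PDF p. 28).

WHAT IS REPRODUCED.  The SPACE (1.34) of SKELETON rows `B13.Lem1` («Lemma 1 (1.33)–(1.36)») and `B13.Lem2` («Lemma 2 (1.41)–(1.43)»), until
now carried only by the abstract field `B13.StepData.sp1 : Dk.Dom → Set Φ` (*"`sp1 Y` = the space (1.34)"*), and the last sentence of
Lemma 2 (the gauge clause) FOR THIS SPACE.  Since p245800 (`B12RegularSpaces111`, this seat gen 2) the first factor `U^c_{k+1}(Y, ·, ·, ·)`
is a concrete set; this file types the product and proves its elementary members.  NOT reproduced: the functions `V′_k`, `V_k`, their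
analyticity, (1.33), (1.35), (1.36), (1.41)–(1.43) (rows of record over `B13.StepData`), and the gauge invariance OF THE FUNCTIONS («a simple
consequence of the statement in Sect. I.3 … and of the fact that the operations in this section preserve the gauge invariance» — by assertion,
cell GAPS.md G-B13-06).

THE PRINT, verbatim.  p. 9, Lemma 1: *«For each term in the sum there exists a function V′_k(Y, 𝐔, 𝐉, B), defined and analytic on the space
U^c_{k+1}(Y, (1+β)α₀, (1+β)α₁, α₀) × {B : |B| < ε₁g_k⁻¹ on Y}, (1.34)  i.e. it depends on configurations 𝐔, 𝐉, B restricted to the interior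
of Y»*.  p. 11, Lemma 2: *«For each term in the sum there exists a function V_k(Y, 𝐔, 𝐉, B), defined and analytic on the space (1.34), and
satisfying the corresponding equality (1.35). … The functions V_k(Y, 𝐔, 𝐉, B), and both terms in (1.42), are gauge invariant with respect to
the simultaneous gauge transformations (I.3.29), for Gᶜ-valued transformations u in a sufficiently small neighborhood of all G-valued
transformations.  Let us remark that the last statement is a simple consequence of the statement in Sect. I.3, in the paragraph containing
(I.3.29), and of the fact that the operations in this section preserve the gauge invariance.»*  p. 11, §2: *«In the last section we have
represented the fluctuation field action in the form (I.1.7) for j = k + 1, with the analyticity properties and bounds slightly better than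
demanded by the inductive assumption.»*  [I] p. 276: *«The functions (3.25), (3.26) are gauge invariant with respect to the simultaneous gauge
transformations  𝐔 → 𝐔^u, 𝐉 → R(u)𝐉, B → R(u)B, (3.29)  for Gᶜ-valued transformations u in a sufficiently small neighborhood of G-valued
transformations, so that the configurations after the transformations belong to proper spaces also.»*  [I] p. 263: *«The spaces
U^c_j(X, α₀, α₁) are, by the definition, gauge invariant also.»* (a union of `Gᶜ`-orbits, [I] p. 262).

THE TYPING (carriers OF RECORD, nothing re-declared).  The first factor IS `B12RegularSpaces111.space 𝓜 F c ((1+β)α₀) ((1+β)α₁) α₀` for the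
single-scale frame `F` of `Y` read at scale `k+1` (`StepConsts c`, `c.j = k+1`, `c.ξ = L^{−(k+1)}`) — the union of (I.1.10)-orbits under
`Gᶜ`-valued `u` of the pairs satisfying (i)–(iv).  The second factor is `ballOn Y r` = the bond fields `B : PBond P i → 𝔸` (same lattice level
and value algebra as `𝐉`) with «|B| < r on Y» (`Y.bonds`; in print `r = ε₁g_k⁻¹`, kept as the two letters `ε₁`, `g`).  The action (I.3.29) on
triples is `act329 u = (B12RegularSpaces111.act u, B12RegularSpaces111.adJ u)` («B → R(u)B», `R(u)B(b) = u(b₋)B(b)u(b₋)⁻¹`).  PROVED here: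
`mem_space134_iff`; `space_prod_subset_space134` (the inductive assumption's `U^c_{k+1}(Y, α₀, α₁) × {B : …}` lies in (1.34), `β ≥ 0` — «slightly
better than demanded»); `space134_mono`; the gauge clause: `fst_act329_mem_iff` (first factor, ALL `Gᶜ`-valued `u` — [I] p. 263 «by the
definition», `B12RegularSpaces111.act_mem_space_iff`), `ballOn_adJ_iff` (`G`-valued `u`: isometry), `adJ_mem_ballOn_dilate` (`Gᶜ`-valued `u`
with `‖u(x)‖‖u(x)⁻¹‖ ≤ K`: the ball of radius `r` is carried into the ball of radius `Kr` — the «sufficiently small neighborhood» made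
quantitative: `K → 1` at `G`), `act329_mem_space134_iff` (`G`-valued), `act329_mem_space134_dilate` (`Gᶜ`-valued, dilated ball);
`unitTriple_mem_space134` (non-vacuity, given that the (iv)-data send `1` to unit / zero configurations).  NOT here: see above; the companion
statement for the SECOND member of (I.3.16) (conditions (i)–(iii) themselves under `Gᶜ`-valued `u` near `G`, where the constants move) is the
sibling file `B12Spaces329Near`.  No `Prop` placeholder, no new fact; axioms standard.  Unit `lit-balaban-p07` (Phase-2 seat p07 gen 4; TAKING
line HOME/STATUS.md 2026-08-21T04:15:06Z), HOME `run/shared/lean/pub/lit-balaban/`.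
-/

namespace Literature.MathematicalPhysics.QuantumFieldTheory.Balaban1983to89.B13Space134

open Literature.MathematicalPhysics.QuantumFieldTheory.Balaban1983to89
open Literature.MathematicalPhysics.QuantumFieldTheory.Balaban1983to89.B12RegularSpaces111
open Literature.MathematicalPhysics.QuantumFieldTheory.Balaban1983to89.B12RegularSpaces111Mono
open Literature.MathematicalPhysics.QuantumFieldTheory.Balaban1983to89.B12RegularSpaces111Gauge

noncomputable section

/-! ## §1. The `B`-factor: `{B : |B| < r on Y}` -/

section Ball

variable {P : Params} {i : ℕ} {𝔸 : Type*} [NormedRing 𝔸]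

/-- The second factor of (1.34): bond fields `B` with «|B| < r on Y» (`r = ε₁g_k⁻¹` in print; «on Y» = at the bonds of the region `Y`).
[cite: Balaban1988RG2Cluster, (1.34) p.9] -/
def ballOn (Y : Region P i) (r : ℝ) : Set (PBond P i → 𝔸) :=
  {B | ∀ b ∈ Y.bonds, ‖B b‖ < r}

/-- Membership in the `B`-factor, unfolded. [cite: Balaban1988RG2Cluster, (1.34) p.9] -/
theorem mem_ballOn_iff {Y : Region P i} {r : ℝ} (B : PBond P i → 𝔸) : B ∈ ballOn Y r ↔ ∀ b ∈ Y.bonds, ‖B b‖ < r :=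
  Iff.rfl

/-- The `B`-ball is monotone in the radius. [cite: Balaban1988RG2Cluster, (1.34) p.9] -/
theorem ballOn_mono (Y : Region P i) {r r' : ℝ} (h : r ≤ r') : (ballOn Y r : Set (PBond P i → 𝔸)) ⊆ ballOn Y r' :=
  fun _ hB b hb => (hB b hb).trans_le h

/-- `B = 0` lies in the ball for `r > 0`. [cite: Balaban1988RG2Cluster, (1.34) p.9] -/
theorem zero_mem_ballOn (Y : Region P i) {r : ℝ} (hr : 0 < r) : (0 : PBond P i → 𝔸) ∈ ballOn Y r :=
  fun _ _ => by rw [Pi.zero_apply, norm_zero]; exact hr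

end Ball

/-! ## §2. The space (1.34) -/

section Space

variable {P : Params} {i : ℕ} {𝔸 : Type*} [NormedRing 𝔸] [NormedAlgebra ℂ 𝔸] [CompleteSpace 𝔸]
variable (𝓜 : Model 𝔸)

/-- **The space (1.34)**: `U^c_{k+1}(Y, (1+β)α₀, (1+β)α₁, α₀) × {B : |B| < ε₁g_k⁻¹ on Y}` — the single-scale space of [I] §1
(`B12RegularSpaces111.space`, the union of (I.1.10)-orbits of the pairs satisfying (i)–(iv)) for the frame `F` of `Y` read at scale `k+1`
(`c.j = k+1`), radii `(1+β)α₀, (1+β)α₁, α₀`, times the `B`-ball on `Y` of radius `ε₁g⁻¹` (`g = g_k`). [cite: Balaban1988RG2Cluster, (1.34) p.9] -/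
def space134 (F : Frame P i 𝔸) (c : StepConsts) (β α₀ α₁ ε₁ g : ℝ) : Set (FieldPair P i 𝔸ˣ 𝔸 × (PBond P i → 𝔸)) :=
  space 𝓜 F c ((1 + β) * α₀) ((1 + β) * α₁) α₀ ×ˢ ballOn F.X (ε₁ * g⁻¹)

variable {𝓜}

/-- Membership in (1.34) IS: `(𝐔, 𝐉) ∈ U^c_{k+1}(Y, (1+β)α₀, (1+β)α₁, α₀)` and `|B| < ε₁g_k⁻¹` on `Y`.
[cite: Balaban1988RG2Cluster, (1.34) p.9] -/
theorem mem_space134_iff {F : Frame P i 𝔸} {c : StepConsts} {β α₀ α₁ ε₁ g : ℝ} (Ψ : FieldPair P i 𝔸ˣ 𝔸 × (PBond P i → 𝔸)) :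
    Ψ ∈ space134 𝓜 F c β α₀ α₁ ε₁ g ↔
      Ψ.1 ∈ space 𝓜 F c ((1 + β) * α₀) ((1 + β) * α₁) α₀ ∧ ∀ b ∈ F.X.bonds, ‖Ψ.2 b‖ < ε₁ * g⁻¹ :=
  Iff.rfl

/-- **The inductive assumption's space times the ball lies in (1.34)**: `U^c_{k+1}(Y, α₀, α₁) × {B : |B| < ε₁g_k⁻¹ on Y} ⊆ (1.34)` for
`β ≥ 0`, `α₀, α₁ ≥ 0`, `O(1)LMB ≥ 0` — «with the analyticity properties and bounds slightly better than demanded by the inductive assumption»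
(p. 11; `B12RegularSpaces111Mono.space_mono`). [cite: Balaban1988RG2Cluster, (1.34) p.9] -/
theorem space_prod_subset_space134 {F : Frame P i 𝔸} {c : StepConsts} (hc : 0 ≤ c.cB) {β α₀ α₁ : ℝ} (hβ : 0 ≤ β) (hα₀ : 0 ≤ α₀)
    (hα₁ : 0 ≤ α₁) (ε₁ g : ℝ) :
    space' 𝓜 F c α₀ α₁ ×ˢ ballOn F.X (ε₁ * g⁻¹) ⊆ space134 𝓜 F c β α₀ α₁ ε₁ g := by
  refine Set.prod_mono (space_mono hc ?_ ?_ le_rfl) le_rfl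
  · have := mul_le_mul_of_nonneg_right (show (1 : ℝ) ≤ 1 + β by linarith) hα₀; linarith
  · have := mul_le_mul_of_nonneg_right (show (1 : ℝ) ≤ 1 + β by linarith) hα₁; linarith

/-- (1.34) is monotone in `β` and in the radius of the ball (`α₀, α₁ ≥ 0`, `O(1)LMB ≥ 0`). [cite: Balaban1988RG2Cluster, (1.34) p.9] -/
theorem space134_mono {F : Frame P i 𝔸} {c : StepConsts} (hc : 0 ≤ c.cB) {β β' α₀ α₁ ε₁ ε₁' g : ℝ} (hβ : β ≤ β')
    (hα₀ : 0 ≤ α₀) (hα₁ : 0 ≤ α₁) (hε : ε₁ * g⁻¹ ≤ ε₁' * g⁻¹) :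
    space134 𝓜 F c β α₀ α₁ ε₁ g ⊆ space134 𝓜 F c β' α₀ α₁ ε₁' g :=
  Set.prod_mono
    (space_mono hc (mul_le_mul_of_nonneg_right (by linarith) hα₀) (mul_le_mul_of_nonneg_right (by linarith) hα₁) le_rfl)
    (ballOn_mono F.X hε)

end Space

/-! ## §3. The gauge clause of Lemma 2 for the space (1.34): the transformations (I.3.29) on `(𝐔, 𝐉, B)` -/

section Gauge

variable {P : Params} {i : ℕ} {𝔸 : Type*} [NormedRing 𝔸]

/-- **(I.3.29) on triples**: «𝐔 → 𝐔^u, 𝐉 → R(u)𝐉, B → R(u)B» — `(𝐔, 𝐉)` by (I.1.10) (`B12RegularSpaces111.act`) and `B` by the adjoint action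
`R(u)B(b) = u(b₋)B(b)u(b₋)⁻¹` (`B12RegularSpaces111.adJ`). [cite: Balaban1987RG1, (3.29) p.276] -/
def act329 (u : Site P i → 𝔸ˣ) (Ψ : FieldPair P i 𝔸ˣ 𝔸 × (PBond P i → 𝔸)) : FieldPair P i 𝔸ˣ 𝔸 × (PBond P i → 𝔸) :=
  (act u Ψ.1, adJ u Ψ.2)

/-- The components of (I.3.29) on triples. [cite: Balaban1987RG1, (3.29) p.276] -/
theorem act329_fst (u : Site P i → 𝔸ˣ) (Ψ : FieldPair P i 𝔸ˣ 𝔸 × (PBond P i → 𝔸)) : (act329 u Ψ).1 = act u Ψ.1 := rfl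

/-- The components of (I.3.29) on triples. [cite: Balaban1987RG1, (3.29) p.276] -/
theorem act329_snd (u : Site P i → 𝔸ˣ) (Ψ : FieldPair P i 𝔸ˣ 𝔸 × (PBond P i → 𝔸)) : (act329 u Ψ).2 = adJ u Ψ.2 := rfl

/-- (I.3.29) on triples is an action: `1` acts trivially. [cite: Balaban1987RG1, (3.29) p.276] -/
theorem act329_one (Ψ : FieldPair P i 𝔸ˣ 𝔸 × (PBond P i → 𝔸)) : act329 (1 : Site P i → 𝔸ˣ) Ψ = Ψ := by
  refine Prod.ext (act_one Ψ.1) (funext fun b => ?_)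
  show ((1 : 𝔸ˣ) : 𝔸) * Ψ.2 b * ↑(1 : 𝔸ˣ)⁻¹ = Ψ.2 b
  rw [inv_one, Units.val_one, one_mul, mul_one]

/-- (I.3.29) on triples is an action: `(vu)` acts as `v` after `u`. [cite: Balaban1987RG1, (3.29) p.276] -/
theorem act329_mul (v u : Site P i → 𝔸ˣ) (Ψ : FieldPair P i 𝔸ˣ 𝔸 × (PBond P i → 𝔸)) :
    act329 (v * u) Ψ = act329 v (act329 u Ψ) :=
  Prod.ext (act_mul v u Ψ.1) (adJ_mul v u Ψ.2)

/-- `‖uXu⁻¹‖ ≤ ‖u‖‖u⁻¹‖·‖X‖` in any normed ring (no hypothesis on `u`). [folklore] -/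
private theorem norm_conj_le_mul (u : 𝔸ˣ) (X : 𝔸) : ‖(u : 𝔸) * X * ↑u⁻¹‖ ≤ ‖(u : 𝔸)‖ * ‖(↑u⁻¹ : 𝔸)‖ * ‖X‖ :=
  calc ‖(u : 𝔸) * X * ↑u⁻¹‖ ≤ ‖(u : 𝔸) * X‖ * ‖(↑u⁻¹ : 𝔸)‖ := norm_mul_le _ _
    _ ≤ ‖(u : 𝔸)‖ * ‖X‖ * ‖(↑u⁻¹ : 𝔸)‖ := by gcongr; exact norm_mul_le _ _
    _ = ‖(u : 𝔸)‖ * ‖(↑u⁻¹ : 𝔸)‖ * ‖X‖ := by ring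

/-- **The `B`-ball under `G`-valued `u`** (`‖·‖ ≤ 1` on `G`: `R(u)` is an isometry, `B12RegularSpaces111Gauge.norm_conj_eq`):
`R(u)B ∈ {|B| < r on Y} ↔ B ∈ {|B| < r on Y}`. [cite: Balaban1988RG2Cluster, Lemma 2 p.11] -/
theorem ballOn_adJ_iff {G : Subgroup 𝔸ˣ} (hG1 : ∀ g ∈ G, ‖(g : 𝔸)‖ ≤ 1) {u : Site P i → 𝔸ˣ} (hu : ∀ x, u x ∈ G) (Y : Region P i)
    (r : ℝ) (B : PBond P i → 𝔸) : adJ u B ∈ ballOn Y r ↔ B ∈ ballOn Y r := by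
  refine forall₂_congr fun b _ => ?_
  rw [show adJ u B b = (u b.src : 𝔸) * B b * ↑(u b.src)⁻¹ from rfl, norm_conj_eq hG1 (hu b.src)]

/-- **The `B`-ball under `Gᶜ`-valued `u` near `G`**, quantitatively: if `‖u(x)‖‖u(x)⁻¹‖ ≤ K` at every site, `K > 0` (at `G`-valued
`u` one has `K = 1`; «a sufficiently small neighborhood of all G-valued transformations» = `K` close to `1`), then `R(u)` carries
`{|B| < r on Y}` into `{|B| < Kr on Y}` — «so that the configurations after the transformations belong to proper spaces also» ([I] p. 276).
[cite: Balaban1988RG2Cluster, Lemma 2 p.11] -/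
theorem adJ_mem_ballOn_dilate {u : Site P i → 𝔸ˣ} {K : ℝ} (hK0 : 0 < K) (hK : ∀ x, ‖(u x : 𝔸)‖ * ‖(↑(u x)⁻¹ : 𝔸)‖ ≤ K)
    (Y : Region P i) (r : ℝ) {B : PBond P i → 𝔸} (hB : B ∈ ballOn Y r) : adJ u B ∈ ballOn Y (K * r) := by
  intro b hb
  calc ‖adJ u B b‖ = ‖(u b.src : 𝔸) * B b * ↑(u b.src)⁻¹‖ := rfl
    _ ≤ ‖(u b.src : 𝔸)‖ * ‖(↑(u b.src)⁻¹ : 𝔸)‖ * ‖B b‖ := norm_conj_le_mul (u b.src) (B b)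
    _ ≤ K * ‖B b‖ := mul_le_mul_of_nonneg_right (hK b.src) (norm_nonneg _)
    _ < K * r := mul_lt_mul_of_pos_left (hB b hb) hK0

/-- If moreover `Kr ≤ r′`, the transformed field lies in the ball of radius `r′` («belong to proper spaces also»).
[cite: Balaban1988RG2Cluster, Lemma 2 p.11] -/
theorem adJ_mem_ballOn_of_le {u : Site P i → 𝔸ˣ} {K : ℝ} (hK0 : 0 < K) (hK : ∀ x, ‖(u x : 𝔸)‖ * ‖(↑(u x)⁻¹ : 𝔸)‖ ≤ K)
    (Y : Region P i) {r r' : ℝ} (hrr : K * r ≤ r') {B : PBond P i → 𝔸} (hB : B ∈ ballOn Y r) : adJ u B ∈ ballOn Y r' :=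
  ballOn_mono Y hrr (adJ_mem_ballOn_dilate hK0 hK Y r hB)

variable [NormedAlgebra ℂ 𝔸] [CompleteSpace 𝔸] {𝓜 : Model 𝔸}

/-- **The first factor of (1.34) is invariant under ALL `Gᶜ`-valued gauge transformations** ([I] p. 263: «The spaces U^c_j(X, α₀, α₁) are,
by the definition, gauge invariant» — a union of `Gᶜ`-orbits; `B12RegularSpaces111.act_mem_space_iff`): for `Gᶜ`-valued `u`,
`(𝐔, 𝐉)^u ∈ U^c_{k+1}(Y, (1+β)α₀, (1+β)α₁, α₀) ↔ (𝐔, 𝐉) ∈ U^c_{k+1}(Y, (1+β)α₀, (1+β)α₁, α₀)`. [cite: Balaban1988RG2Cluster, Lemma 2 p.11] -/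
theorem fst_act329_mem_iff {F : Frame P i 𝔸} {c : StepConsts} {β α₀ α₁ : ℝ} (Ψ : FieldPair P i 𝔸ˣ 𝔸 × (PBond P i → 𝔸))
    {u : Site P i → 𝔸ˣ} (hu : ∀ x, u x ∈ 𝓜.Gc) :
    (act329 u Ψ).1 ∈ space 𝓜 F c ((1 + β) * α₀) ((1 + β) * α₁) α₀ ↔ Ψ.1 ∈ space 𝓜 F c ((1 + β) * α₀) ((1 + β) * α₁) α₀ :=
  act_mem_space_iff Ψ.1 hu

/-- **(1.34) is invariant under `G`-valued gauge transformations (I.3.29)** (`‖·‖ ≤ 1` on `G`, `G ≤ Gᶜ`): the first factor by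
`fst_act329_mem_iff`, the `B`-ball by `ballOn_adJ_iff`. [cite: Balaban1988RG2Cluster, Lemma 2 p.11] -/
theorem act329_mem_space134_iff (hG1 : ∀ g ∈ 𝓜.G, ‖(g : 𝔸)‖ ≤ 1) (hGc : 𝓜.G ≤ 𝓜.Gc) {F : Frame P i 𝔸} {c : StepConsts}
    {β α₀ α₁ ε₁ g : ℝ} (Ψ : FieldPair P i 𝔸ˣ 𝔸 × (PBond P i → 𝔸)) {u : Site P i → 𝔸ˣ} (hu : ∀ x, u x ∈ 𝓜.G) :
    act329 u Ψ ∈ space134 𝓜 F c β α₀ α₁ ε₁ g ↔ Ψ ∈ space134 𝓜 F c β α₀ α₁ ε₁ g := by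
  show (act329 u Ψ).1 ∈ _ ∧ (act329 u Ψ).2 ∈ ballOn F.X (ε₁ * g⁻¹) ↔ Ψ.1 ∈ _ ∧ Ψ.2 ∈ ballOn F.X (ε₁ * g⁻¹)
  rw [fst_act329_mem_iff Ψ fun x => hGc (hu x), act329_snd, ballOn_adJ_iff hG1 hu]

/-- **(1.34) under `Gᶜ`-valued gauge transformations near the `G`-valued ones** (the gauge clause of Lemma 2 for the space): for `Gᶜ`-valued
`u` with `‖u(x)‖‖u(x)⁻¹‖ ≤ K` at every site (`K > 0`), (I.3.29) carries (1.34) with `B`-radius `ε₁g⁻¹` into (1.34) with `B`-radius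
`(Kε₁)g⁻¹` — the first factor EXACTLY invariant (union of `Gᶜ`-orbits), the ball dilated by `K` («for Gᶜ-valued transformations u in a
sufficiently small neighborhood of all G-valued transformations … so that the configurations after the transformations belong to proper
spaces also»). [cite: Balaban1988RG2Cluster, Lemma 2 p.11] -/
theorem act329_mem_space134_dilate {F : Frame P i 𝔸} {c : StepConsts} {β α₀ α₁ ε₁ g : ℝ}
    {Ψ : FieldPair P i 𝔸ˣ 𝔸 × (PBond P i → 𝔸)} (hΨ : Ψ ∈ space134 𝓜 F c β α₀ α₁ ε₁ g) {u : Site P i → 𝔸ˣ}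
    (hu : ∀ x, u x ∈ 𝓜.Gc) {K : ℝ} (hK0 : 0 < K) (hK : ∀ x, ‖(u x : 𝔸)‖ * ‖(↑(u x)⁻¹ : 𝔸)‖ ≤ K) :
    act329 u Ψ ∈ space134 𝓜 F c β α₀ α₁ (K * ε₁) g := by
  refine ⟨(fst_act329_mem_iff Ψ hu).2 hΨ.1, ?_⟩
  rw [act329_snd, mul_assoc]
  exact adJ_mem_ballOn_dilate hK0 hK F.X _ hΨ.2

end Gauge

/-! ## §4. Non-vacuity -/

section NonVacuity

variable {P : Params} {i : ℕ} {𝔸 : Type*} [NormedRing 𝔸] [NormedAlgebra ℂ 𝔸] [CompleteSpace 𝔸]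
variable {𝓜 : Model 𝔸}

/-- **(1.34) is non-empty**: the triple `(𝐔, 𝐉, B) = (1, 0, 0)` lies in it for `β > −1`, positive `α₀, α₁, ε₁g⁻¹`, `O(1)LMB > 0`,
`ξ, L ≠ 0`, as soon as the (iv)-data send the unit configuration to unit / zero configurations (`B12RegularSpaces111Mono.unitPair_mem_space`).
[cite: Balaban1988RG2Cluster, (1.34) p.9] -/
theorem unitTriple_mem_space134 (F : Frame P i 𝔸) {c : StepConsts} (hξ : c.ξ ≠ 0) (hL : c.L ≠ 0) (hc : 0 < c.cB)
    {β α₀ α₁ ε₁ g : ℝ} (hβ : 0 < 1 + β) (h₀ : 0 < α₀) (h₁ : 0 < α₁) (hε : 0 < ε₁ * g⁻¹) (hUn : ∀ n, F.bg.Un n 1 = 1)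
    (hJn : ∀ n b, F.bg.Jn n 1 b = 0) :
    ((unitPair, 0) : FieldPair P i 𝔸ˣ 𝔸 × (PBond P i → 𝔸)) ∈ space134 𝓜 F c β α₀ α₁ ε₁ g :=
  ⟨unitPair_mem_space F hξ hL hc (mul_pos hβ h₀) (mul_pos hβ h₁) h₀ hUn hJn, zero_mem_ballOn F.X hε⟩

end NonVacuity

end

end Literature.MathematicalPhysics.QuantumFieldTheory.Balaban1983to89.B13Space134
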